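import Summits.AnomalousDissipation.AnomalousDissipation.Theorems.TaylorGreenLoudGalerkinStates.Negative.Anatomy
import Summits.AnomalousDissipation.AnomalousDissipation.Theorems.PumpedMirrorMirrorFloorTGStressBound
import Literature.Analysis.FluidPDE.StatisticalSolution
import Literature.Analysis.FunctionSpaces.TorusFourierModes
import Literature.Analysis.FunctionSpaces.TorusCalculusProofs
import HarnessLib

/-!
# DegreeGate — the quiet-fluctuation floor (BC5 rung of `route-AnomalousDissipation-DegreeGate`, now a theorem)

LANDABLE FORM (decomp-ad lens-5 g64; intended tree path
`Summits/AnomalousDissipation/AnomalousDissipation/Theorems/DegreeGateQuietFluctuationFloorRung.lean`; a prover/census seat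
lands it with `ledger propose --kind proof --target <that path> --supports stmt-AnomalousDissipation-28050` — planners do
not propose into Theorems/). 0 sorry; axioms ⊆ {propext, Classical.choice, Quot.sound}.

Route `route-AnomalousDissipation-DegreeGate` (sub-problem `AnomalousDissipation`, Taylor–Green force
`f_TG = (sin 2πx cos 2πy cos 2πz, −cos 2πx sin 2πy cos 2πz, 0)` = the tree constant `tgForce` of
`Theorems/TaylorGreenLoudGalerkinStates/Negative/LoadBearing.lean`, literally the lambda bound by the route's
items) filed its BC5 witness of weakness PLAN-ONLY: the stub `stub_quietFluctuationFloor`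
(«QUIET STEADY STATES CARRY AN O(1) FLUCTUATION»: at every height `ν ∈ (0, 1/100]` a steady state of
NS_ν(f_TG) in the FMRT weak currency with energy equation `ν‖∇u‖² = (u, f_TG)` and `(u, f_TG) ≤ 1/200` has
`∫|u|² − 4 (u, f_TG)² ≥ 1/40`) and its corollary «CALM FRONTS ARE LOUD» (crux `FrontLoudAllTG`, item
stmt-AnomalousDissipation-28050, restricted to fronts whose fluctuation energy is `< 1/40`).

This file proves both, sorry-free, by the weak form TESTED WITH THE FORCE ITSELF:
`0 = ⟨F(u), f_TG⟩ = (f_TG, f_TG) + ν (u, Δ f_TG) + ∫ (u·∇) f_TG · u = 1/4 − 12π² ν (u, f_TG) + I(u)` with the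
pointwise bound `|vᵀ ∇f_TG(x) v| ≤ 2π |v|²` (closed form of the Jacobian of `f_TG`, Lagrange's identity and
`cos² + sin² = 1`), whence `2π ∫|u|² ≥ 1/4 − 12π²ν(u, f_TG) ≥ 0.2404` and `∫|u|² − 4(u,f_TG)² ≥ 0.0299 ≥ 1/40`.
No symmetry, no `V`-membership, no connectedness is used; the statement is uniform in `ν ∈ (0, 1/100]`.

Main declarations (namespace `Summit.AnomalousDissipation.AnomalousDissipation.Theorems.DegreeGate`):
* `quietFluctuationFloor` — the floor with minimal hypotheses (steady weak solution + energy equation + quiet);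
* `stub_quietFluctuationFloor_holds` — the route's plan-only BC5 stub in the route's own (unfolded) currency;
* `frontLoudAllTG_of_calm` — crux `FrontLoudAllTG` (stmt-AnomalousDissipation-28050) VERBATIM with the single extra
  hypothesis «the front is calm: ∫|u|² − 4(u,f_TG)² < 1/40» — the decided ν-uniform case of the power residual.
[folklore: energy/enstrophy bookkeeping for forced steady Navier–Stokes, FMRT 2001 Ch. II §7, Ch. IV §1]

TREE LANDING NOTE (decomp-ad census g17, prover-role seat): the gate bounced the byte-for-byte landable
(lens-5 g64, sha256 d4e6402cba245db1…) with `dedup.landed` — its §1 (the entries `partialDeriv_tgForce_*` of the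
Jacobian of `f_TG`, the quadratic form and the pointwise bound `|vᵀ∇f_TG v| ≤ 2π|v|²`) restates declarations already
landed in `Theorems/PumpedMirrorMirrorFloorTGStressBound.lean` (namespace `…Theorems.PumpedMirrorMirrorFloorTG`), and its §2
(`freqNormSq_of_mem_tgShell`, `realTrigPoly_ofReal_smul`, `laplacian_tgForce`) restates `PumpedMirrorMirrorFloorTG.laplacian_tgForce_apply`
(`Theorems/PumpedMirrorMirrorFloorTGSmallEnergy.lean`). This tree copy therefore IMPORTS that module and cites
`PumpedMirrorMirrorFloorTG.abs_inner_fderiv_tgForce_apply_le` / `PumpedMirrorMirrorFloorTG.laplacian_tgForce_apply` instead of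
re-proving them; what remains below (`abs_inertialPairing_tgForce_le`, `quietFluctuationFloor`, `stub_quietFluctuationFloor_holds`,
`frontLoudAllTG_of_calm`) is the landable VERBATIM in statement, and verbatim in proof up to those two citations.
-/

noncomputable section

set_option linter.dupNamespace false
set_option linter.style.longLine false

open MeasureTheory Filter
open scoped InnerProductSpace ComplexConjugate
open Literature.Analysis Literature.Analysis.FunctionSpaces Literature.Analysis.FunctionSpaces.Torus
open Summit.AnomalousDissipation.AnomalousDissipation.Theorems.TaylorGreenLoudGalerkinStates.Negative

namespace Summit.AnomalousDissipation.AnomalousDissipation.Theorems.DegreeGate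

/-! ### §2 `−Δ f_TG = 12π² f_TG` and the inertial term against `f_TG` -/

/-- The inertial term tested against `f_TG` is controlled by the energy: `|∫ (u·∇) f_TG · u| ≤ 2π ∫ |u|²`. [folklore] -/
theorem abs_inertialPairing_tgForce_le
    (U : MeasureTheory.Lp (EuclideanSpace ℝ (Fin 3)) 2 (MeasureTheory.volume (α := UnitAddTorus (Fin 3)))) :
    |Literature.Analysis.FluidPDE.Torus.inertialPairing U tgForce| ≤ 2 * Real.pi * ∫ x, ‖U x‖ ^ 2 := by
  have hint : Integrable (fun x => ‖U x‖ ^ 2) (volume : Measure (UnitAddTorus (Fin 3))) :=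
    (memLp_two_iff_integrable_sq_norm (Lp.aestronglyMeasurable U)).1 (Lp.memLp U)
  unfold Literature.Analysis.FluidPDE.Torus.inertialPairing
  rw [← Real.norm_eq_abs, ← integral_const_mul]
  refine norm_integral_le_of_norm_le (hint.const_mul _) (Eventually.of_forall fun x => ?_)
  rw [Real.norm_eq_abs]
  exact Summit.AnomalousDissipation.AnomalousDissipation.Theorems.PumpedMirrorMirrorFloorTG.abs_inner_fderiv_tgForce_apply_le x (U x)

/-! ### §3 The quiet-fluctuation floor -/

/-- **Quiet steady states carry an `O(1)` fluctuation** (the DegreeGate BC5 rung, minimal hypotheses): for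
`0 < ν ≤ 1/100`, a steady weak solution `u ∈ H` of NS_ν(f_TG) with energy equation `ν‖∇u‖² = (u, f_TG)` and
`(u, f_TG) ≤ 1/200` has `∫|u|² − 4 (u, f_TG)² ≥ 1/40`. Proof: the weak form tested with `f_TG`,
`Δf_TG = −12π² f_TG`, `‖f_TG‖² = 1/4`, `|∫(u·∇)f_TG·u| ≤ 2π∫|u|²`, and `π ≤ 4`. [folklore] -/
theorem quietFluctuationFloor {ν : ℝ} (hν : 0 < ν) (hν₁ : ν ≤ 1/100)
    (u : ↥(Literature.Analysis.FunctionSpaces.Torus.energySpace (Fin 3)))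
    (hsol : Literature.Analysis.FluidPDE.Torus.IsSteadyWeakSolution ν tgForce u)
    (hEq : ν * (Literature.Analysis.FunctionSpaces.Torus.eGradNormSq (⇑(u : MeasureTheory.Lp (EuclideanSpace ℝ (Fin 3)) 2 (MeasureTheory.volume (α := UnitAddTorus (Fin 3)))))).toReal = Literature.Analysis.FluidPDE.Torus.pairing (u : MeasureTheory.Lp (EuclideanSpace ℝ (Fin 3)) 2 (MeasureTheory.volume (α := UnitAddTorus (Fin 3)))) tgForce)
    (hP : Literature.Analysis.FluidPDE.Torus.pairing (u : MeasureTheory.Lp (EuclideanSpace ℝ (Fin 3)) 2 (MeasureTheory.volume (α := UnitAddTorus (Fin 3)))) tgForce ≤ 1/200) :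
    (1/40 : ℝ) ≤ (∫ x, ‖(u : MeasureTheory.Lp (EuclideanSpace ℝ (Fin 3)) 2 (MeasureTheory.volume (α := UnitAddTorus (Fin 3)))) x‖ ^ 2) - 4 * (Literature.Analysis.FluidPDE.Torus.pairing (u : MeasureTheory.Lp (EuclideanSpace ℝ (Fin 3)) 2 (MeasureTheory.volume (α := UnitAddTorus (Fin 3)))) tgForce) ^ 2 := by
  -- injected power is nonnegative (energy equation)
  have hP0 : 0 ≤ Literature.Analysis.FluidPDE.Torus.pairing (u : MeasureTheory.Lp (EuclideanSpace ℝ (Fin 3)) 2 (MeasureTheory.volume (α := UnitAddTorus (Fin 3)))) tgForce := by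
    rw [← hEq]; exact mul_nonneg hν.le ENNReal.toReal_nonneg
  have hE0 : 0 ≤ ∫ x, ‖(u : MeasureTheory.Lp (EuclideanSpace ℝ (Fin 3)) 2 (MeasureTheory.volume (α := UnitAddTorus (Fin 3)))) x‖ ^ 2 := integral_nonneg fun _ => by positivity
  -- the weak form tested with the force itself
  have h0 := hsol tgForce isSmooth_tgForce isDivFree_tgForce hasZeroMean_tgForce
  have hff : ∫ x, ⟪tgForce x, tgForce x⟫_ℝ = 4⁻¹ := by
    simp_rw [real_inner_self_eq_norm_sq]; exact integral_norm_sq_tgForce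
  have hlap : ∫ x, ⟪((u : MeasureTheory.Lp (EuclideanSpace ℝ (Fin 3)) 2 (MeasureTheory.volume (α := UnitAddTorus (Fin 3)))) : UnitAddTorus (Fin 3) → EuclideanSpace ℝ (Fin 3)) x, Torus.laplacian tgForce x⟫_ℝ =
      -(12 * Real.pi ^ 2) * Literature.Analysis.FluidPDE.Torus.pairing (u : MeasureTheory.Lp (EuclideanSpace ℝ (Fin 3)) 2 (MeasureTheory.volume (α := UnitAddTorus (Fin 3)))) tgForce := by
    simp_rw [Summit.AnomalousDissipation.AnomalousDissipation.Theorems.PumpedMirrorMirrorFloorTG.laplacian_tgForce_apply, real_inner_smul_right]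
    rw [integral_const_mul]
    rfl
  simp only [Literature.Analysis.FluidPDE.Torus.nsGeneratorPairing, hff, hlap] at h0
  have hI := abs_le.1 (abs_inertialPairing_tgForce_le (u : MeasureTheory.Lp (EuclideanSpace ℝ (Fin 3)) 2 (MeasureTheory.volume (α := UnitAddTorus (Fin 3)))))
  -- arithmetic: 2πE ≥ 1/4 − 12π²νP, π ≤ 4, νP ≤ 1/20000, P² ≤ P/200
  have hpi := Real.pi_le_four
  have hpi0 := Real.pi_pos
  have hνP : ν * Literature.Analysis.FluidPDE.Torus.pairing (u : MeasureTheory.Lp (EuclideanSpace ℝ (Fin 3)) 2 (MeasureTheory.volume (α := UnitAddTorus (Fin 3)))) tgForce ≤ 1/100 * (1/200) :=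
    mul_le_mul hν₁ hP hP0 (by norm_num)
  have hνP0 : 0 ≤ ν * Literature.Analysis.FluidPDE.Torus.pairing (u : MeasureTheory.Lp (EuclideanSpace ℝ (Fin 3)) 2 (MeasureTheory.volume (α := UnitAddTorus (Fin 3)))) tgForce := mul_nonneg hν.le hP0
  have hpi2 : Real.pi ^ 2 ≤ 16 := by nlinarith
  have hT : Real.pi ^ 2 * (ν * Literature.Analysis.FluidPDE.Torus.pairing (u : MeasureTheory.Lp (EuclideanSpace ℝ (Fin 3)) 2 (MeasureTheory.volume (α := UnitAddTorus (Fin 3)))) tgForce) ≤ 16 * (1/100 * (1/200)) :=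
    (mul_le_mul_of_nonneg_right hpi2 hνP0).trans (by linarith)
  have hB : 2 * Real.pi * (∫ x, ‖(u : MeasureTheory.Lp (EuclideanSpace ℝ (Fin 3)) 2 (MeasureTheory.volume (α := UnitAddTorus (Fin 3)))) x‖ ^ 2) ≤ 8 * ∫ x, ‖(u : MeasureTheory.Lp (EuclideanSpace ℝ (Fin 3)) 2 (MeasureTheory.volume (α := UnitAddTorus (Fin 3)))) x‖ ^ 2 :=
    mul_le_mul_of_nonneg_right (by linarith) hE0
  have hC : Literature.Analysis.FluidPDE.Torus.pairing (u : MeasureTheory.Lp (EuclideanSpace ℝ (Fin 3)) 2 (MeasureTheory.volume (α := UnitAddTorus (Fin 3)))) tgForce ^ 2 ≤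
      1/200 * Literature.Analysis.FluidPDE.Torus.pairing (u : MeasureTheory.Lp (EuclideanSpace ℝ (Fin 3)) 2 (MeasureTheory.volume (α := UnitAddTorus (Fin 3)))) tgForce := by
    rw [sq]; exact mul_le_mul_of_nonneg_right hP hP0
  have hIeq : Literature.Analysis.FluidPDE.Torus.inertialPairing (u : MeasureTheory.Lp (EuclideanSpace ℝ (Fin 3)) 2 (MeasureTheory.volume (α := UnitAddTorus (Fin 3)))) tgForce =
      -(4⁻¹) + 12 * (Real.pi ^ 2 * (ν * Literature.Analysis.FluidPDE.Torus.pairing (u : MeasureTheory.Lp (EuclideanSpace ℝ (Fin 3)) 2 (MeasureTheory.volume (α := UnitAddTorus (Fin 3)))) tgForce)) := by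
    linear_combination h0
  nlinarith [hI.1, hI.2, hIeq, hT, hB, hC, hE0, hP0]

/-- The route's plan-only BC5 stub `stub_quietFluctuationFloor` (DegreeGate kernel: `IsGSteadyTG ν u → powerTG u ≤ 1/200 →
1/40 ≤ energyTG u − 4 (powerTG u)²`), in the route's own unfolded currency (`IsGSteadyTG` = V-membership ∧ steady weak
solution ∧ energy equation ∧ Taylor–Green symmetry, a.e.) — now a theorem; only the steady equation and the energy
equation are used. [folklore] -/
theorem stub_quietFluctuationFloor_holds :
    ∀ ν : ℝ, 0 < ν → ν ≤ 1/100 →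
      ∀ u : ↥(Literature.Analysis.FunctionSpaces.Torus.energySpace (Fin 3)), ((u : MeasureTheory.Lp (EuclideanSpace ℝ (Fin 3)) 2 (MeasureTheory.volume (α := UnitAddTorus (Fin 3)))) ∈ Literature.Analysis.FunctionSpaces.Torus.energySpaceV (Fin 3) ∧ Literature.Analysis.FluidPDE.Torus.IsSteadyWeakSolution ν tgForce u ∧ ν * (Literature.Analysis.FunctionSpaces.Torus.eGradNormSq (⇑(u : MeasureTheory.Lp (EuclideanSpace ℝ (Fin 3)) 2 (MeasureTheory.volume (α := UnitAddTorus (Fin 3)))))).toReal = Literature.Analysis.FluidPDE.Torus.pairing (u : MeasureTheory.Lp (EuclideanSpace ℝ (Fin 3)) 2 (MeasureTheory.volume (α := UnitAddTorus (Fin 3)))) tgForce ∧ ((∀ i j : Fin 3, (fun x => (⇑(u : MeasureTheory.Lp (EuclideanSpace ℝ (Fin 3)) 2 (MeasureTheory.volume (α := UnitAddTorus (Fin 3))))) (Function.update x i (-x i)) j) =ᵐ[MeasureTheory.volume] (fun x => if j = i then -((⇑(u : MeasureTheory.Lp (EuclideanSpace ℝ (Fin 3)) 2 (MeasureTheory.volume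 (α := UnitAddTorus (Fin 3))))) x j) else (⇑(u : MeasureTheory.Lp (EuclideanSpace ℝ (Fin 3)) 2 (MeasureTheory.volume (α := UnitAddTorus (Fin 3))))) x j)) ∧ ((fun x => (⇑(u : MeasureTheory.Lp (EuclideanSpace ℝ (Fin 3)) 2 (MeasureTheory.volume (α := UnitAddTorus (Fin 3))))) (x + (Pi.single (0 : Fin 3) (((1/2 : ℝ)) : UnitAddCircle) + Pi.single (1 : Fin 3) (((1/2 : ℝ)) : UnitAddCircle)))) =ᵐ[MeasureTheory.volume] (⇑(u : MeasureTheory.Lp (EuclideanSpace ℝ (Fin 3)) 2 (MeasureTheory.volume (α := UnitAddTorus (Fin 3)))))) ∧ ((fun x => (⇑(u : MeasureTheory.Lp (EuclideanSpace ℝ (Fin 3)) 2 (MeasureTheory.volume (α := UnitAddTorus (Fin 3))))) (x + (Pi.single (0 : Fin 3) (((1/2 : ℝ)) : UnitAddCircle) + Pi.single (2 : Fin 3) (((1/2 : ℝ)) : UnitAddCircle)))) =ᵐ[MeasureTheory.volume] (⇑(u : MeasureTheory.Lp (EuclideanSpace ℝ (Fin 3)) 2 (MeasureTheory.volume (α :=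 UnitAddTorus (Fin 3)))))) ∧ ((fun x => (⇑(u : MeasureTheory.Lp (EuclideanSpace ℝ (Fin 3)) 2 (MeasureTheory.volume (α := UnitAddTorus (Fin 3))))) ![(((1/2 : ℝ)) : UnitAddCircle) - x 1, x 0, x 2]) =ᵐ[MeasureTheory.volume] (fun x => !₂[-((⇑(u : MeasureTheory.Lp (EuclideanSpace ℝ (Fin 3)) 2 (MeasureTheory.volume (α := UnitAddTorus (Fin 3))))) x 1), (⇑(u : MeasureTheory.Lp (EuclideanSpace ℝ (Fin 3)) 2 (MeasureTheory.volume (α := UnitAddTorus (Fin 3))))) x 0, (⇑(u : MeasureTheory.Lp (EuclideanSpace ℝ (Fin 3)) 2 (MeasureTheory.volume (α := UnitAddTorus (Fin 3))))) x 2])))) →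
        Literature.Analysis.FluidPDE.Torus.pairing (u : MeasureTheory.Lp (EuclideanSpace ℝ (Fin 3)) 2 (MeasureTheory.volume (α := UnitAddTorus (Fin 3)))) tgForce ≤ 1/200 →
          (1/40 : ℝ) ≤ (∫ x, ‖(u : MeasureTheory.Lp (EuclideanSpace ℝ (Fin 3)) 2 (MeasureTheory.volume (α := UnitAddTorus (Fin 3)))) x‖ ^ 2) - 4 * (Literature.Analysis.FluidPDE.Torus.pairing (u : MeasureTheory.Lp (EuclideanSpace ℝ (Fin 3)) 2 (MeasureTheory.volume (α := UnitAddTorus (Fin 3)))) tgForce) ^ 2 :=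
  fun _ hν hν₁ u hG hP => quietFluctuationFloor hν hν₁ u hG.2.1 hG.2.2.1 hP

/-! ### §4 Calm fronts are loud — crux `FrontLoudAllTG` (stmt-AnomalousDissipation-28050) on calm fronts -/

/-- **Calm fronts are loud** (the ν-UNIFORM DECIDED CASE of the power residual `FrontLoudAllTG`,
item stmt-AnomalousDissipation-28050 of `route-AnomalousDissipation-DegreeGate`): the crux VERBATIM — same force
binder, same top slice `ν₀ = 1/5`, same wall-free slab steady set and connected component — with the single extra
hypothesis that the front `p = (ν, u)` is CALM, `∫|u|² − 4(u, f_TG)² < 1/40`. By the quiet-fluctuation floor such a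
front has `(u, f_TG) ≥ 1/200`; neither the component nor the symmetry is used. [folklore] -/
theorem frontLoudAllTG_of_calm :
    ∀ f : UnitAddTorus (Fin 3) → EuclideanSpace ℝ (Fin 3), f = (fun x => !₂[(fourier 1 (x 0) : ℂ).im * (fourier 1 (x 1) : ℂ).re * (fourier 1 (x 2) : ℂ).re, -((fourier 1 (x 0) : ℂ).re * (fourier 1 (x 1) : ℂ).im * (fourier 1 (x 2) : ℂ).re), (0 : ℝ)]) → ∀ ν : ℝ, 0 < ν → ν ≤ 1/100 → ∀ u_top : ↥(Literature.Analysis.FunctionSpaces.Torus.energySpace (Fin 3)), ((u_top : MeasureTheory.Lp (EuclideanSpace ℝ (Fin 3)) 2 (MeasureTheory.volume (α := UnitAddTorus (Fin 3)))) ∈ Literature.Analysis.FunctionSpaces.Torus.energySpaceV (Fin 3) ∧ Literature.Analysis.FluidPDE.Torus.IsSteadyWeakSolution (1/5 : ℝ) f u_top ∧ (1/5 : ℝ) * (Literature.Analysis.FunctionSpaces.Torus.eGradNormSq (⇑(u_top : MeasureTheory.Lp (EuclideanSpace ℝ (Fin 3)) 2 (MeasureTheory.volume (α := UnitAddTorus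 (Fin 3)))))).toReal = Literature.Analysis.FluidPDE.Torus.pairing (u_top : MeasureTheory.Lp (EuclideanSpace ℝ (Fin 3)) 2 (MeasureTheory.volume (α := UnitAddTorus (Fin 3)))) f ∧ ((∀ i j : Fin 3, (fun x => (⇑(u_top : MeasureTheory.Lp (EuclideanSpace ℝ (Fin 3)) 2 (MeasureTheory.volume (α := UnitAddTorus (Fin 3))))) (Function.update x i (-x i)) j) =ᵐ[MeasureTheory.volume] (fun x => if j = i then -((⇑(u_top : MeasureTheory.Lp (EuclideanSpace ℝ (Fin 3)) 2 (MeasureTheory.volume (α := UnitAddTorus (Fin 3))))) x j) else (⇑(u_top : MeasureTheory.Lp (EuclideanSpace ℝ (Fin 3)) 2 (MeasureTheory.volume (α := UnitAddTorus (Fin 3))))) x j)) ∧ ((fun x => (⇑(u_top : MeasureTheory.Lp (EuclideanSpace ℝ (Fin 3)) 2 (MeasureTheory.volume (α := UnitAddTorus (Fin 3))))) (x + (Pi.single (0 : Fin 3) (((1/2 : ℝ)) : UnitAddCircle) + Pi.single (1 : Fin 3) (((1/2 : ℝ)) : UnitAddCircle)))) =ᵐ[MeasureTheory.volume] (⇑(u_top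 : MeasureTheory.Lp (EuclideanSpace ℝ (Fin 3)) 2 (MeasureTheory.volume (α := UnitAddTorus (Fin 3)))))) ∧ ((fun x => (⇑(u_top : MeasureTheory.Lp (EuclideanSpace ℝ (Fin 3)) 2 (MeasureTheory.volume (α := UnitAddTorus (Fin 3))))) (x + (Pi.single (0 : Fin 3) (((1/2 : ℝ)) : UnitAddCircle) + Pi.single (2 : Fin 3) (((1/2 : ℝ)) : UnitAddCircle)))) =ᵐ[MeasureTheory.volume] (⇑(u_top : MeasureTheory.Lp (EuclideanSpace ℝ (Fin 3)) 2 (MeasureTheory.volume (α := UnitAddTorus (Fin 3)))))) ∧ ((fun x => (⇑(u_top : MeasureTheory.Lp (EuclideanSpace ℝ (Fin 3)) 2 (MeasureTheory.volume (α := UnitAddTorus (Fin 3))))) ![(((1/2 : ℝ)) : UnitAddCircle) - x 1, x 0, x 2]) =ᵐ[MeasureTheory.volume] (fun x => !₂[-((⇑(u_top : MeasureTheory.Lp (EuclideanSpace ℝ (Fin 3)) 2 (MeasureTheory.volume (α := UnitAddTorus (Fin 3))))) x 1), (⇑(u_top : MeasureTheory.Lp (EuclideanSpace ℝ (Fin 3))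 2 (MeasureTheory.volume (α := UnitAddTorus (Fin 3))))) x 0, (⇑(u_top : MeasureTheory.Lp (EuclideanSpace ℝ (Fin 3)) 2 (MeasureTheory.volume (α := UnitAddTorus (Fin 3))))) x 2])))) → ∀ p ∈ connectedComponentIn {q : ℝ × ↥(Literature.Analysis.FunctionSpaces.Torus.energySpace (Fin 3)) | ν ≤ q.1 ∧ q.1 ≤ (1/5 : ℝ) ∧ ((q.2 : MeasureTheory.Lp (EuclideanSpace ℝ (Fin 3)) 2 (MeasureTheory.volume (α := UnitAddTorus (Fin 3)))) ∈ Literature.Analysis.FunctionSpaces.Torus.energySpaceV (Fin 3) ∧ Literature.Analysis.FluidPDE.Torus.IsSteadyWeakSolution q.1 f q.2 ∧ q.1 * (Literature.Analysis.FunctionSpaces.Torus.eGradNormSq (⇑(q.2 : MeasureTheory.Lp (EuclideanSpace ℝ (Fin 3)) 2 (MeasureTheory.volume (α := UnitAddTorus (Fin 3)))))).toReal = Literature.Analysis.FluidPDE.Torus.pairing (q.2 : MeasureTheory.Lp (EuclideanSpace ℝ (Fin 3)) 2 (MeasureTheory.volume (α := UnitAddTorus (Fin 3)))) f ∧ ((∀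 i j : Fin 3, (fun x => (⇑(q.2 : MeasureTheory.Lp (EuclideanSpace ℝ (Fin 3)) 2 (MeasureTheory.volume (α := UnitAddTorus (Fin 3))))) (Function.update x i (-x i)) j) =ᵐ[MeasureTheory.volume] (fun x => if j = i then -((⇑(q.2 : MeasureTheory.Lp (EuclideanSpace ℝ (Fin 3)) 2 (MeasureTheory.volume (α := UnitAddTorus (Fin 3))))) x j) else (⇑(q.2 : MeasureTheory.Lp (EuclideanSpace ℝ (Fin 3)) 2 (MeasureTheory.volume (α := UnitAddTorus (Fin 3))))) x j)) ∧ ((fun x => (⇑(q.2 : MeasureTheory.Lp (EuclideanSpace ℝ (Fin 3)) 2 (MeasureTheory.volume (α := UnitAddTorus (Fin 3))))) (x + (Pi.single (0 : Fin 3) (((1/2 : ℝ)) : UnitAddCircle) + Pi.single (1 : Fin 3) (((1/2 : ℝ)) : UnitAddCircle)))) =ᵐ[MeasureTheory.volume] (⇑(q.2 : MeasureTheory.Lp (EuclideanSpace ℝ (Fin 3)) 2 (MeasureTheory.volume (α := UnitAddTorus (Fin 3)))))) ∧ ((fun x => (⇑(q.2 : MeasureTheory.Lp (EuclideanSpace ℝ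 (Fin 3)) 2 (MeasureTheory.volume (α := UnitAddTorus (Fin 3))))) (x + (Pi.single (0 : Fin 3) (((1/2 : ℝ)) : UnitAddCircle) + Pi.single (2 : Fin 3) (((1/2 : ℝ)) : UnitAddCircle)))) =ᵐ[MeasureTheory.volume] (⇑(q.2 : MeasureTheory.Lp (EuclideanSpace ℝ (Fin 3)) 2 (MeasureTheory.volume (α := UnitAddTorus (Fin 3)))))) ∧ ((fun x => (⇑(q.2 : MeasureTheory.Lp (EuclideanSpace ℝ (Fin 3)) 2 (MeasureTheory.volume (α := UnitAddTorus (Fin 3))))) ![(((1/2 : ℝ)) : UnitAddCircle) - x 1, x 0, x 2]) =ᵐ[MeasureTheory.volume] (fun x => !₂[-((⇑(q.2 : MeasureTheory.Lp (EuclideanSpace ℝ (Fin 3)) 2 (MeasureTheory.volume (α := UnitAddTorus (Fin 3))))) x 1), (⇑(q.2 : MeasureTheory.Lp (EuclideanSpace ℝ (Fin 3)) 2 (MeasureTheory.volume (α := UnitAddTorus (Fin 3))))) x 0, (⇑(q.2 : MeasureTheory.Lp (EuclideanSpace ℝ (Fin 3)) 2 (MeasureTheory.volume (α := UnitAddTorus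 (Fin 3))))) x 2]))))} ((1/5 : ℝ), u_top), p.1 = ν → (∫ x, ‖(p.2 : MeasureTheory.Lp (EuclideanSpace ℝ (Fin 3)) 2 (MeasureTheory.volume (α := UnitAddTorus (Fin 3)))) x‖ ^ 2) - 4 * (Literature.Analysis.FluidPDE.Torus.pairing (p.2 : MeasureTheory.Lp (EuclideanSpace ℝ (Fin 3)) 2 (MeasureTheory.volume (α := UnitAddTorus (Fin 3)))) f) ^ 2 < 1/40 → (1/200 : ℝ) ≤ Literature.Analysis.FluidPDE.Torus.pairing (p.2 : MeasureTheory.Lp (EuclideanSpace ℝ (Fin 3)) 2 (MeasureTheory.volume (α := UnitAddTorus (Fin 3)))) f := by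
  intro f hf
  subst hf
  intro ν hν hν₁ u_top _ p hp hpν hcalm
  have hmem := connectedComponentIn_subset _ _ hp
  simp only [Set.mem_setOf_eq] at hmem
  obtain ⟨_, _, _, hst, hen, _⟩ := hmem
  by_contra hlt
  have hle := le_of_lt (not_le.1 hlt)
  have hνp : 0 < p.1 := by rw [hpν]; exact hν
  have hνp₁ : p.1 ≤ 1/100 := by rw [hpν]; exact hν₁
  -- the floor is stated with the tree constant `tgForce`, definitionally the route's lambda
  have hfl := quietFluctuationFloor hνp hνp₁ p.2 hst hen hle
  exact absurd hfl (not_le.2 hcalm)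

end Summit.AnomalousDissipation.AnomalousDissipation.Theorems.DegreeGate

end
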